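/-
Copyright (c) 2026. Released under Apache 2.0 license.
-/
import Literature.NumberTheory.EllipticCurves.ModularCurveEtaQuotientsProofs
import HarnessLib

/-!
# Newman's `η`-quotient theorem WITH CHARACTER (Savitt 2025, Thm. 1, even weight)

Topic `Literature/NumberTheory/EllipticCurves`; namespace
`Literature.NumberTheory.EllipticCurves.ModularForms` (proof companion of
`ModularCurveEtaQuotientsProofs`). Cell `bsd-print-cf2`, typer seat `-ty2` (g51), deliverable **(A1)**
of the pen's SUMMON 2026-08-31T03:11:49Z for crux `stmt-BirchSwinnertonDyer-20509` (THEOREM A of the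
LEAD's skeleton v10, stub `stub_offTYZ_firstNormSquare_R2`, needs the transformation law of
`s = η(16τ)³/(η(8τ)η(32τ)²)`, whose `∏ δ^{r_δ} = 1/2` is NOT a square). EVERYTHING HERE IS PROVED
(no definition, no named fact, no `sorry`).

`ModularCurveEtaQuotientsProofs` proves Newman's theorem for TRIVIAL character: under
`NewmanCond N r k` — `Σ r_δ = 2k`, `Σ δ r_δ ≡ Σ (N/δ) r_δ ≡ 0 (mod 24)` AND `∏ δ^{|r_δ|}` a perfect
square — and `k` even, `f = ∏_{δ∣N} η(δτ)^{r_δ}` satisfies `f(γτ) = (cτ+d)^k f(τ)` on `Γ₀(N)`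
(`etaQuotient_smul_of_mem_Gamma0`). The square hypothesis enters at exactly one place, Newman's
Jacobi-symbol identity `newman_jacobi_prod_eq_one` (`∏_δ (c_δ/|d|)^{r_δ} = (t²/|d|) = 1`). This file
removes it: the same computation gives

* `newman_jacobi_prod_eq_jacobiSym` — `∏_δ (c_δ/|d|)^{r_δ} = (s₀/|d|)`, `s₀ := ∏_δ δ^{|r_δ|}`
  (for `gcd(c,d) = 1`, `d` odd, `N ∣ c`, `Σ r_δ` even), with NO square hypothesis;
* `etaQuotient_SL2_smul_of_odd_char` — the core case `c > 0`, `d` odd: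
  `f(γτ) = (s₀/|d|) (cτ+d)^k f(τ)`;
* `etaQuotient_smul_of_mem_Gamma0_of_odd` — **Savitt's Thm. 1 in even weight**: for every
  `γ = (a b; c d) ∈ Γ₀(N)` with `d` ODD, `f(γτ) = (s₀/|d|)·(cτ+d)^k·f(τ)`; the slash form
  `etaQuotient_slash_of_mem_Gamma0_of_odd`; and when `N` is even every `γ ∈ Γ₀(N)` has `d` odd
  (`odd_d_of_mem_Gamma0_of_even`), whence `etaQuotient_smul_of_mem_Gamma0_char` /
  `etaQuotient_slash_of_mem_Gamma0_char` with no parity hypothesis;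
* `newmanChar_eq_of_natAbs_mod_eq` — the factor `(s₀/|d|)` only depends on `|d| mod 4s₀`
  (Mathlib `jacobiSym.mod_right`), and `newmanChar_eq_one_of_isSquare` recovers the trivial
  character under the square hypothesis (consistency with `etaQuotient_smul_of_mem_Gamma0`).

## Faithfulness to the print

Savitt 2025, Thm. 1 (materialised p. 2): for `k = ½ Σ r_m ∈ ℤ`, `f = ∏_{0<m∣N} η(mz)^{r_m}` is a weakly
holomorphic modular form on `Γ₁(N)` iff `Σ m r_m ≡ 0 ≡ Σ (N/m) r_m (mod 24)`, «Furthermore the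
Nebentypus character of `f` is the character `ψ(d) = ((-1)^k s / d)`, where `s = ∏_m m^{r_m}` and the
representative `d` of a class in `(ℤ/Nℤ)^×` is chosen to be ODD», with the extended Jacobi symbol
`(m/d) = sgn(m)·(m/|d|)` for `d < 0`. For EVEN `k` (the only case the tree's second Petersson–Knopp
form of the multiplier handles, and the case of weight `0` needed downstream) `(-1)^k = 1`, `s > 0`, and
`(m^{r_m}/d) = (m/|d|)^{r_m} = (m/|d|)^{|r_m|}` (a sign), so `ψ(d) = (s₀/|d|)` with `s₀ = ∏ m^{|r_m|}`
— the statement proved here, for every `γ ∈ Γ₀(N)` whose `d` is odd (all of them when `N` is even;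
for odd `N` and even `d`, `γ = (γT⁻¹)T` has the odd representative `d - c ≡ d (mod N)`). NOT proved
here: the necessity half of Thm. 1, odd `k`, and the assertion that `d ↦ ψ(d)` is well defined on
`(ℤ/Nℤ)^×` (we only record the period `4s₀`, `newmanChar_eq_of_natAbs_mod_eq`).

## References

* D. Savitt, *An elementary proof of Newman's eta-quotient theorem*, Res. Number Theory 11 (2025),
  arXiv:2507.16225 — Thm. 1 and the convention on `(m/d)` right after it (p. 2). [Savitt2025]
* M. Newman, *Construction and application of a class of modular functions (II)*, Proc. London
  Math. Soc. (3) 9 (1959), 373–387, Thm. 1. [Newman1959]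
* G. Ligozat, *Courbes modulaires de genre 1*, Mém. SMF 43 (1975), Prop. 3.2.1. [Ligozat1975]
-/

noncomputable section

open UpperHalfPlane hiding I
open ModularForm Complex Matrix.SpecialLinearGroup Filter Asymptotics CongruenceSubgroup
open scoped MatrixGroups Real ModularForm CongruenceSubgroup Topology Manifold NumberTheorySymbols

namespace Literature.NumberTheory.EllipticCurves.ModularForms

/-! ### Newman's Jacobi-symbol identity without the square hypothesis -/

/-- **Newman's Jacobi-symbol identity, with character**: for `gcd(c, d) = 1`, `d` odd, `N ∣ c` and
`Σ r_δ` even, `∏_δ (c_δ/|d|)^{r_δ} = (∏_δ δ^{|r_δ|} / |d|)` where `c = δ c_δ`; indeed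
`(c_δ/|d|) = (c/|d|)(δ/|d|)`, `∏ (c/|d|)^{r_δ} = ((c/|d|)²)^k = 1` and `(δ/|d|)^{r_δ} = (δ/|d|)^{|r_δ|}`.
This is `newman_jacobi_prod_eq_one` with its hypothesis `IsSquare (∏ δ^{|r_δ|})` removed.
[cite: Savitt2025, Thm. 1] -/
theorem newman_jacobi_prod_eq_jacobiSym (N : ℕ) (r : ℕ → ℤ) (k : ℤ)
    (hk : ∑ δ ∈ N.divisors, r δ = 2 * k)
    (c d : ℤ) (hNc : (N : ℤ) ∣ c) (hcop : IsCoprime c d) (hd : Odd d) (cδ : ℕ → ℤ)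
    (hcδ : ∀ δ ∈ N.divisors, c = δ * cδ δ) :
    ∏ δ ∈ N.divisors, ((J(cδ δ | d.natAbs) : ℤ) : ℂ) ^ (r δ) =
      ((J(((∏ δ ∈ N.divisors, δ ^ (r δ).natAbs : ℕ) : ℤ) | d.natAbs) : ℤ) : ℂ) := by
  set m := d.natAbs with hm
  have hmodd : Odd m := Int.natAbs_odd.mpr hd
  haveI : NeZero m := ⟨fun h ↦ by rw [h] at hmodd; exact absurd hmodd (by decide)⟩
  -- `u = (c/|d|) = ±1`
  have hcg : c.gcd m = 1 := by
    have : Int.gcd c d = 1 := Int.isCoprime_iff_gcd_eq_one.mp hcop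
    simpa [Int.gcd, hm, Int.natAbs_abs] using this
  have hu : J(c | m) * J(c | m) = 1 := by
    rcases jacobiSym.eq_one_or_neg_one hcg with h | h <;> rw [h] <;> norm_num
  -- each `δ ∣ N` is coprime to `d`
  have hδcop : ∀ δ ∈ N.divisors, IsCoprime (δ : ℤ) d := fun δ hδ ↦
    hcop.of_isCoprime_of_dvd_left
      ((Int.natCast_dvd_natCast.mpr (Nat.dvd_of_mem_divisors hδ)).trans hNc)
  have hw : ∀ δ ∈ N.divisors, J((δ : ℤ) | m) * J((δ : ℤ) | m) = 1 := fun δ hδ ↦ by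
    have hg : (δ : ℤ).gcd m = 1 := by
      have := Int.isCoprime_iff_gcd_eq_one.mp (hδcop δ hδ)
      simpa [Int.gcd, hm, Int.natAbs_abs] using this
    rcases jacobiSym.eq_one_or_neg_one hg with h | h <;> rw [h] <;> norm_num
  -- `(c_δ/|d|) = (c/|d|)(δ/|d|)`
  have hfac : ∀ δ ∈ N.divisors, J(cδ δ | m) = J(c | m) * J((δ : ℤ) | m) := fun δ hδ ↦ by
    have : J(c | m) = J((δ : ℤ) | m) * J(cδ δ | m) := by rw [hcδ δ hδ, jacobiSym.mul_left]
    rw [this]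
    linear_combination (-J(cδ δ | m)) * hw δ hδ
  rw [Finset.prod_congr rfl fun δ hδ ↦ by rw [hfac δ hδ]]
  simp_rw [Int.cast_mul, mul_zpow, Finset.prod_mul_distrib]
  -- the `(c/|d|)` part: `u^{Σ r} = (u²)^k = 1`
  have huC : ((J(c | m) : ℤ) : ℂ) * ((J(c | m) : ℤ) : ℂ) = 1 := by exact_mod_cast hu
  have h1 : ∏ δ ∈ N.divisors, ((J(c | m) : ℤ) : ℂ) ^ (r δ) = 1 := by
    have hne : ((J(c | m) : ℤ) : ℂ) ≠ 0 := fun h ↦ by rw [h, zero_mul] at huC; exact zero_ne_one huC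
    rw [show (∏ δ ∈ N.divisors, ((J(c | m) : ℤ) : ℂ) ^ (r δ)) =
        ((J(c | m) : ℤ) : ℂ) ^ (∑ δ ∈ N.divisors, r δ) by
      induction N.divisors using Finset.induction_on with
      | empty => simp
      | insert a s ha ih => rw [Finset.prod_insert ha, Finset.sum_insert ha, ih, zpow_add₀ hne],
      hk, two_mul, zpow_add₀ hne, ← mul_zpow, huC, one_zpow]
  -- the `(δ/|d|)` part: `∏ (δ/|d|)^{|r_δ|} = (s₀/|d|)`
  have h2 : ∏ δ ∈ N.divisors, ((J((δ : ℤ) | m) : ℤ) : ℂ) ^ (r δ) =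
      ((J(((∏ δ ∈ N.divisors, δ ^ (r δ).natAbs : ℕ) : ℤ) | m) : ℤ) : ℂ) := by
    rw [Finset.prod_congr rfl fun δ hδ ↦ unit_zpow_eq_pow_natAbs (by exact_mod_cast hw δ hδ) (r δ)]
    have : (∏ δ ∈ N.divisors, ((J((δ : ℤ) | m) : ℤ) : ℂ) ^ (r δ).natAbs) =
        ((∏ δ ∈ N.divisors, J((δ : ℤ) | m) ^ (r δ).natAbs : ℤ) : ℂ) := by push_cast; rfl
    rw [this, prod_jacobiSym_pow]
  rw [h1, h2, one_mul]

/-! ### The character factor `(s₀/|d|)` -/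

/-- The character value `(∏_δ δ^{|r_δ|} / |d|)` only depends on `|d|` modulo `4 ∏_δ δ^{|r_δ|}` (for odd
`d`): quadratic reciprocity in Mathlib's form `jacobiSym.mod_right`. [cite: Savitt2025, Thm. 1 (ψ is a character; App. A (7))] -/
theorem newmanChar_eq_of_natAbs_mod_eq (N : ℕ) (r : ℕ → ℤ) {d d' : ℤ} (hd : Odd d) (hd' : Odd d')
    (h : d.natAbs % (4 * ∏ δ ∈ N.divisors, δ ^ (r δ).natAbs) =
      d'.natAbs % (4 * ∏ δ ∈ N.divisors, δ ^ (r δ).natAbs)) :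
    J(((∏ δ ∈ N.divisors, δ ^ (r δ).natAbs : ℕ) : ℤ) | d.natAbs) =
      J(((∏ δ ∈ N.divisors, δ ^ (r δ).natAbs : ℕ) : ℤ) | d'.natAbs) := by
  rw [jacobiSym.mod_right _ (Int.natAbs_odd.mpr hd), jacobiSym.mod_right _ (Int.natAbs_odd.mpr hd'),
    Int.natAbs_natCast, h]

/-- Under the square hypothesis of `NewmanCond` the character is trivial on every `d` coprime to the
level-divisors: `(t²/|d|) = 1` for `gcd(c, d) = 1`, `N ∣ c` (consistency with
`newman_jacobi_prod_eq_one`). [cite: Savitt2025, Thm. 1] -/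
theorem newmanChar_eq_one_of_isSquare (N : ℕ) (r : ℕ → ℤ)
    (hsq : IsSquare (∏ δ ∈ N.divisors, δ ^ (r δ).natAbs)) (c d : ℤ) (hNc : (N : ℤ) ∣ c)
    (hcop : IsCoprime c d) :
    J(((∏ δ ∈ N.divisors, δ ^ (r δ).natAbs : ℕ) : ℤ) | d.natAbs) = 1 := by
  have hδcop : ∀ δ ∈ N.divisors, IsCoprime (δ : ℤ) d := fun δ hδ ↦
    hcop.of_isCoprime_of_dvd_left
      ((Int.natCast_dvd_natCast.mpr (Nat.dvd_of_mem_divisors hδ)).trans hNc)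
  obtain ⟨t, ht⟩ := hsq
  rw [ht]
  have htcop : IsCoprime (t : ℤ) d := by
    have hprod : IsCoprime ((∏ δ ∈ N.divisors, δ ^ (r δ).natAbs : ℕ) : ℤ) d := by
      rw [Nat.cast_prod]
      exact IsCoprime.prod_left fun δ hδ ↦ by
        rw [Nat.cast_pow]; exact (hδcop δ hδ).pow_left
    rw [ht, Nat.cast_mul] at hprod
    exact hprod.of_mul_left_left
  have htg : (t : ℤ).gcd d.natAbs = 1 := by
    have := Int.isCoprime_iff_gcd_eq_one.mp htcop
    simpa [Int.gcd, Int.natAbs_abs] using this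
  rw [show ((t * t : ℕ) : ℤ) = (t : ℤ) ^ 2 by push_cast; ring, jacobiSym.sq_one' htg]

/-! ### Newman's criterion with character: the core case `c > 0`, `d` odd -/

/-- **Newman's criterion with character, core case** (Newman 1959; Savitt 2025, Thm. 1, even weight):
let `f = ∏_{δ ∣ N} η(δτ)^{r_δ}` with `Σ δ r_δ ≡ 0 (mod 24)`, `Σ (N/δ) r_δ ≡ 0 (mod 24)`, `Σ r_δ = 2k`
with `k` even, and put `s₀ = ∏ δ^{|r_δ|}`. Then for `γ = (a b; c d) ∈ Γ₀(N)` with `c > 0` and `d`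
odd, `f(γτ) = (s₀/|d|)·(cτ + d)^k·f(τ)`. Proof: exactly as `etaQuotient_SL2_smul_of_odd` (the
transformation law `eta_SL2_smul` at the conjugates `γ_δ = (a, bδ; c/δ, d)`), the bracket
`∏_δ v_η(γ_δ)^{r_δ}` being `(s₀/|d|)` by `newman_jacobi_prod_eq_jacobiSym` and
`newman_exponent_sum_dvd`. [cite: Savitt2025, Thm. 1] -/
theorem etaQuotient_SL2_smul_of_odd_char (N : ℕ) (hN : 0 < N) (r : ℕ → ℤ) (k : ℤ) (hkeven : Even k)
    (hk : ∑ δ ∈ N.divisors, r δ = 2 * k)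
    (h1 : (24 : ℤ) ∣ ∑ δ ∈ N.divisors, (δ : ℤ) * r δ)
    (h2 : (24 : ℤ) ∣ ∑ δ ∈ N.divisors, ((N / δ : ℕ) : ℤ) * r δ)
    (γ : SL(2, ℤ)) (hγN : (N : ℤ) ∣ γ 1 0) (hc : 0 < γ 1 0) (hd : Odd (γ 1 1)) (τ : ℍ) :
    etaQuotient N r (γ • τ) =
      ((J(((∏ δ ∈ N.divisors, δ ^ (r δ).natAbs : ℕ) : ℤ) | (γ 1 1).natAbs) : ℤ) : ℂ) *
        ((γ 1 0 : ℂ) * τ + γ 1 1) ^ k * etaQuotient N r τ := by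
  have _ := hN
  obtain ⟨cN, hcN⟩ := hγN
  have hcNpos : 0 < cN := by
    rcases lt_trichotomy cN 0 with h | h | h
    · nlinarith [hcN]
    · rw [h, mul_zero] at hcN; omega
    · exact h
  -- the conjugates `γ_δ`, `c/δ = cN (N/δ)`
  have hcδ : ∀ δ ∈ N.divisors, γ 1 0 = δ * (cN * (N / δ : ℕ)) := fun δ hδ ↦ by
    have hNδ : ((δ : ℕ) : ℤ) * ((N / δ : ℕ) : ℤ) = N := by
      exact_mod_cast Nat.mul_div_cancel' (Nat.dvd_of_mem_divisors hδ)
    rw [hcN, ← hNδ]; ring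
  have hcδpos : ∀ δ ∈ N.divisors, 0 < cN * (N / δ : ℕ) := fun δ hδ ↦
    mul_pos hcNpos (by exact_mod_cast Nat.div_pos (Nat.divisor_le hδ) (Nat.pos_of_mem_divisors hδ))
  set j : ℂ := (γ 1 0 : ℂ) * τ + γ 1 1 with hj
  have hjne : j ≠ 0 := SL2_denom_ne_zero γ τ
  -- each factor
  have hfactor : ∀ δ ∈ N.divisors, η (δ * ((γ • τ : ℍ) : ℂ)) =
      etaMultiplier (γ 0 0) (γ 0 1 * δ) (cN * (N / δ : ℕ)) (γ 1 1) * Complex.sqrt j *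
        η (δ * (τ : ℂ)) := fun δ hδ ↦ by
    have hδ0 := Nat.pos_of_mem_divisors hδ
    obtain ⟨h00, h01, h10, h11⟩ := conjDelta_apply γ δ _ (hcδ δ hδ)
    have := eta_SL2_smul (conjDelta γ δ _ (hcδ δ hδ)) (Or.inl (by rw [h10]; exact hcδpos δ hδ))
      (natMulPt δ hδ0 τ)
    rw [natMul_coe_SL2_smul γ δ hδ0 _ (hcδ δ hδ), this, etaMultiplierSL, h00, h01, h10, h11,
      coe_natMulPt]
    congr 2
    rw [hj]
    have : ((γ 1 0 : ℤ) : ℂ) = δ * (cN * (N / δ : ℕ) : ℤ) := by exact_mod_cast hcδ δ hδ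
    rw [this]; push_cast; ring
  rw [etaQuotient_apply, etaQuotient_apply, Finset.prod_congr rfl fun δ hδ ↦ by rw [hfactor δ hδ]]
  simp_rw [mul_zpow, Finset.prod_mul_distrib]
  -- the automorphy factors: `∏ (√j)^{r_δ} = (√j)^{2k} = j^k`
  have hsqrt : ∏ δ ∈ N.divisors, Complex.sqrt j ^ (r δ) = j ^ k := by
    have hsne : Complex.sqrt j ≠ 0 := fun h ↦ hjne (by rw [← csqrt_sq j, h]; simp)
    rw [show (∏ δ ∈ N.divisors, Complex.sqrt j ^ (r δ)) =
        Complex.sqrt j ^ (∑ δ ∈ N.divisors, r δ) by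
      induction N.divisors using Finset.induction_on with
      | empty => simp
      | insert a s ha ih => rw [Finset.prod_insert ha, Finset.sum_insert ha, ih, zpow_add₀ hsne],
      hk, zpow_mul, show Complex.sqrt j ^ (2 : ℤ) = j by
        rw [show (2 : ℤ) = ((2 : ℕ) : ℤ) from rfl, zpow_natCast, csqrt_sq]]
  -- the multipliers: Jacobi part and exponential part
  have hmult : ∏ δ ∈ N.divisors,
      etaMultiplier (γ 0 0) (γ 0 1 * δ) (cN * (N / δ : ℕ)) (γ 1 1) ^ (r δ) =
        ((J(((∏ δ ∈ N.divisors, δ ^ (r δ).natAbs : ℕ) : ℤ) | (γ 1 1).natAbs) : ℤ) : ℂ) := by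
    rw [Finset.prod_congr rfl fun δ hδ ↦ by
      rw [etaMultiplier_of_odd_d (hcδpos δ hδ) hd, mul_zpow, ← Complex.exp_int_mul]]
    rw [Finset.prod_mul_distrib, ← Complex.exp_sum]
    have hcop : IsCoprime (γ 1 0) (γ 1 1) := by
      refine ⟨γ 1 1 * 0 + -γ 0 1, γ 0 0, ?_⟩
      linear_combination det_entries γ
    rw [newman_jacobi_prod_eq_jacobiSym N r k hk (γ 1 0) (γ 1 1) ⟨cN, hcN⟩ hcop hd
      (fun δ ↦ cN * (N / δ : ℕ)) hcδ]
    obtain ⟨t, ht⟩ := newman_exponent_sum_dvd N r k hkeven hk h1 h2 (γ 0 0) (γ 0 1) cN (γ 1 1) hd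
    rw [show (∑ δ ∈ N.divisors, (r δ : ℂ) * (π * I / 12 *
        (etaP₂ (γ 0 0) (γ 0 1 * δ) (cN * (N / δ : ℕ)) (γ 1 1) : ℤ))) = (t : ℂ) * (2 * π * I) by
      rw [show (t : ℂ) * (2 * π * I) = π * I / 12 * ((24 * t : ℤ) : ℂ) by push_cast; ring, ← ht,
        Int.cast_sum, Finset.mul_sum]
      exact Finset.sum_congr rfl fun δ _ ↦ by push_cast; ring]
    rw [Complex.exp_int_mul_two_pi_mul_I t, mul_one]
  rw [hmult, hsqrt]

/-! ### The whole of `Γ₀(N)` at odd `d`, and every `γ ∈ Γ₀(N)` for even `N` -/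

/-- **Newman's theorem with character on `Γ₀(N)`, even weight** (Savitt 2025, Thm. 1, sufficiency half,
with the Nebentypus `ψ(d) = ((-1)^k s/d)` read at even `k` and odd `d` as `(∏ δ^{|r_δ|} / |d|)`):
if `Σ r_δ = 2k` with `k` even and `Σ δ r_δ ≡ Σ (N/δ) r_δ ≡ 0 (mod 24)`, then for every
`γ = (a b; c d) ∈ Γ₀(N)` with `d` odd,
`f(γτ) = (∏_δ δ^{|r_δ|} / |d|) · (cτ + d)^k · f(τ)`, `f = ∏_{δ∣N} η(δτ)^{r_δ}`.
The cases `c < 0` (`γ ↦ -γ`, `|{-d}| = |d|`, `(-1)^k = 1`) and `c = 0` (`d = ±1`, periodicity) reduce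
to `etaQuotient_SL2_smul_of_odd_char`. [cite: Savitt2025, Thm. 1] -/
theorem etaQuotient_smul_of_mem_Gamma0_of_odd (N : ℕ) (hN : 0 < N) (r : ℕ → ℤ) (k : ℤ)
    (hkeven : Even k) (hk : ∑ δ ∈ N.divisors, r δ = 2 * k)
    (h1 : (24 : ℤ) ∣ ∑ δ ∈ N.divisors, (δ : ℤ) * r δ)
    (h2 : (24 : ℤ) ∣ ∑ δ ∈ N.divisors, ((N / δ : ℕ) : ℤ) * r δ)
    {γ : SL(2, ℤ)} (hγ : γ ∈ Gamma0 N) (hd : Odd (γ 1 1)) (τ : ℍ) :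
    etaQuotient N r (γ • τ) =
      ((J(((∏ δ ∈ N.divisors, δ ^ (r δ).natAbs : ℕ) : ℤ) | (γ 1 1).natAbs) : ℤ) : ℂ) *
        ((γ 1 0 : ℂ) * τ + γ 1 1) ^ k * etaQuotient N r τ := by
  have hNc : (N : ℤ) ∣ γ 1 0 := by
    rw [Gamma0_mem] at hγ
    exact (ZMod.intCast_zmod_eq_zero_iff_dvd _ N).mp hγ
  rcases lt_trichotomy (γ 1 0) 0 with hneg | hzero | hpos
  · -- `c < 0`: use `-γ`
    have h := etaQuotient_SL2_smul_of_odd_char N hN r k hkeven hk h1 h2 (-γ)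
      (by rw [SL_neg_apply]; exact hNc.neg_right) (by rw [SL_neg_apply]; linarith)
      (by rw [SL_neg_apply]; exact hd.neg) τ
    rw [SL_neg_apply, SL_neg_apply, Int.natAbs_neg, show (-γ) • τ = γ • τ by simp] at h
    rw [h]
    push_cast
    rw [show (-(γ 1 0 : ℂ) * τ + -(γ 1 1 : ℂ)) = -((γ 1 0 : ℂ) * τ + γ 1 1) by ring,
      Even.neg_zpow hkeven]
  · -- `c = 0`: `γ = ±Tⁿ`, `d = ±1`, character value `1`
    have hdet := det_entries γ
    rcases SL2Z_d_of_c_eq_zero γ hzero with hd1 | hd1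
    · have ha : γ 0 0 = 1 := by rw [hzero, hd1] at hdet; linarith
      have hcoe : ((γ • τ : ℍ) : ℂ) = (τ : ℂ) + (γ 0 1 : ℤ) := by
        rw [coe_SL2_smul, ha, hzero, hd1]; push_cast; ring
      rw [etaQuotient_of_coe_eq_add_intCast N r h1 hcoe, hzero, hd1]
      simp [jacobiSym.one_right]
    · have ha : γ 0 0 = -1 := by rw [hzero, hd1] at hdet; linarith
      have hcoe : ((γ • τ : ℍ) : ℂ) = (τ : ℂ) + ((-γ 0 1 : ℤ) : ℂ) := by
        rw [coe_SL2_smul, ha, hzero, hd1]; push_cast; ring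
      rw [etaQuotient_of_coe_eq_add_intCast N r h1 hcoe, hzero, hd1]
      simp only [Int.reduceNeg, Int.natAbs_neg, Int.natAbs_one, jacobiSym.one_right, Int.cast_one,
        one_mul, Int.cast_zero, zero_mul, Int.cast_neg, zero_add]
      rw [Even.neg_one_zpow hkeven, one_mul]
  · exact etaQuotient_SL2_smul_of_odd_char N hN r k hkeven hk h1 h2 γ hNc hpos hd τ

/-- **Slash form**: `f ∣[k] γ = (∏ δ^{|r_δ|} / |d|) • f` for `γ ∈ Γ₀(N)` with `d` odd, `k` even, under
Newman's two congruences. [cite: Savitt2025, Thm. 1] -/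
theorem etaQuotient_slash_of_mem_Gamma0_of_odd (N : ℕ) (hN : 0 < N) (r : ℕ → ℤ) (k : ℤ)
    (hkeven : Even k) (hk : ∑ δ ∈ N.divisors, r δ = 2 * k)
    (h1 : (24 : ℤ) ∣ ∑ δ ∈ N.divisors, (δ : ℤ) * r δ)
    (h2 : (24 : ℤ) ∣ ∑ δ ∈ N.divisors, ((N / δ : ℕ) : ℤ) * r δ)
    {γ : SL(2, ℤ)} (hγ : γ ∈ Gamma0 N) (hd : Odd (γ 1 1)) :
    etaQuotient N r ∣[k] γ =
      ((J(((∏ δ ∈ N.divisors, δ ^ (r δ).natAbs : ℕ) : ℤ) | (γ 1 1).natAbs) : ℤ) : ℂ) •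
        etaQuotient N r := by
  funext τ
  rw [SL_slash_apply, ModularGroup.denom_apply,
    etaQuotient_smul_of_mem_Gamma0_of_odd N hN r k hkeven hk h1 h2 hγ hd, Pi.smul_apply,
    smul_eq_mul, mul_assoc, mul_assoc, mul_comm (_ ^ k), mul_assoc,
    ← zpow_add₀ (SL2_denom_ne_zero γ τ), neg_add_cancel, zpow_zero, mul_one]

/-- In `Γ₀(N)` with `N` even the lower-right entry `d` is always odd (since `N ∣ c` makes `c` even
and `ad - bc = 1`), so Savitt's «representative `d` chosen to be odd» is automatic at even level.
[cite: Savitt2025, Thm. 1 (the odd representative d of a class in (ℤ/Nℤ)^×)] -/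
theorem odd_d_of_mem_Gamma0_of_even {N : ℕ} (hNeven : Even N) {γ : SL(2, ℤ)} (hγ : γ ∈ Gamma0 N) :
    Odd (γ 1 1) := by
  have hNc : (N : ℤ) ∣ γ 1 0 := by
    rw [Gamma0_mem] at hγ
    exact (ZMod.intCast_zmod_eq_zero_iff_dvd _ N).mp hγ
  have hceven : Even (γ 1 0) := by
    obtain ⟨n, hn⟩ := hNeven
    obtain ⟨c', hc'⟩ := hNc
    exact ⟨(n : ℤ) * c', by rw [hc', hn]; push_cast; ring⟩
  exact odd_d_of_even_c (det_entries γ) hceven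

/-- **Newman's theorem with character at EVEN level** (no parity hypothesis on `d`): for `N` even,
`k` even, `Σ r_δ = 2k`, `Σ δ r_δ ≡ Σ (N/δ) r_δ ≡ 0 (mod 24)`, and every `γ = (a b; c d) ∈ Γ₀(N)`,
`f(γτ) = (∏ δ^{|r_δ|} / |d|)·(cτ+d)^k·f(τ)`. [cite: Savitt2025, Thm. 1] -/
theorem etaQuotient_smul_of_mem_Gamma0_char (N : ℕ) (hN : 0 < N) (hNeven : Even N) (r : ℕ → ℤ)
    (k : ℤ) (hkeven : Even k) (hk : ∑ δ ∈ N.divisors, r δ = 2 * k)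
    (h1 : (24 : ℤ) ∣ ∑ δ ∈ N.divisors, (δ : ℤ) * r δ)
    (h2 : (24 : ℤ) ∣ ∑ δ ∈ N.divisors, ((N / δ : ℕ) : ℤ) * r δ)
    {γ : SL(2, ℤ)} (hγ : γ ∈ Gamma0 N) (τ : ℍ) :
    etaQuotient N r (γ • τ) =
      ((J(((∏ δ ∈ N.divisors, δ ^ (r δ).natAbs : ℕ) : ℤ) | (γ 1 1).natAbs) : ℤ) : ℂ) *
        ((γ 1 0 : ℂ) * τ + γ 1 1) ^ k * etaQuotient N r τ :=
  etaQuotient_smul_of_mem_Gamma0_of_odd N hN r k hkeven hk h1 h2 hγ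
    (odd_d_of_mem_Gamma0_of_even hNeven hγ) τ

/-- Slash form at even level: `f ∣[k] γ = (∏ δ^{|r_δ|} / |d|) • f` for every `γ ∈ Γ₀(N)`.
[cite: Savitt2025, Thm. 1] -/
theorem etaQuotient_slash_of_mem_Gamma0_char (N : ℕ) (hN : 0 < N) (hNeven : Even N) (r : ℕ → ℤ)
    (k : ℤ) (hkeven : Even k) (hk : ∑ δ ∈ N.divisors, r δ = 2 * k)
    (h1 : (24 : ℤ) ∣ ∑ δ ∈ N.divisors, (δ : ℤ) * r δ)
    (h2 : (24 : ℤ) ∣ ∑ δ ∈ N.divisors, ((N / δ : ℕ) : ℤ) * r δ)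
    {γ : SL(2, ℤ)} (hγ : γ ∈ Gamma0 N) :
    etaQuotient N r ∣[k] γ =
      ((J(((∏ δ ∈ N.divisors, δ ^ (r δ).natAbs : ℕ) : ℤ) | (γ 1 1).natAbs) : ℤ) : ℂ) •
        etaQuotient N r :=
  etaQuotient_slash_of_mem_Gamma0_of_odd N hN r k hkeven hk h1 h2 hγ
    (odd_d_of_mem_Gamma0_of_even hNeven hγ)

/-- **Invariance on the kernel of the character**: if moreover `(∏ δ^{|r_δ|} / |d|) = 1` then
`f(γτ) = (cτ+d)^k f(τ)` — e.g. on `Γ₁(N)`-type subgroups where `|d| ≡ ±1` modulo the period.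
[cite: Savitt2025, Thm. 1] -/
theorem etaQuotient_smul_of_mem_Gamma0_of_char_eq_one (N : ℕ) (hN : 0 < N) (r : ℕ → ℤ) (k : ℤ)
    (hkeven : Even k) (hk : ∑ δ ∈ N.divisors, r δ = 2 * k)
    (h1 : (24 : ℤ) ∣ ∑ δ ∈ N.divisors, (δ : ℤ) * r δ)
    (h2 : (24 : ℤ) ∣ ∑ δ ∈ N.divisors, ((N / δ : ℕ) : ℤ) * r δ)
    {γ : SL(2, ℤ)} (hγ : γ ∈ Gamma0 N) (hd : Odd (γ 1 1))
    (hχ : J(((∏ δ ∈ N.divisors, δ ^ (r δ).natAbs : ℕ) : ℤ) | (γ 1 1).natAbs) = 1) (τ : ℍ) :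
    etaQuotient N r (γ • τ) = ((γ 1 0 : ℂ) * τ + γ 1 1) ^ k * etaQuotient N r τ := by
  rw [etaQuotient_smul_of_mem_Gamma0_of_odd N hN r k hkeven hk h1 h2 hγ hd τ, hχ, Int.cast_one,
    one_mul]

end Literature.NumberTheory.EllipticCurves.ModularForms

end
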